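import Literature.Probability.Percolation.RhombusPivotalFromSeparation
import Literature.Probability.Percolation.ArmPatternsFourArm
import Literature.Probability.Percolation.CutPointAltArms
import HarnessLib

/-!
# `Werner2009_lemma62` (Kesten's pivotal count for the rhombus) from the ALTERNATING four-arm calculus (proofs only)

Topic `Literature/Probability/Percolation`; family `crit-perc`. PROOFS ONLY (no definition, no
named fact). Fifth proof file of the named fact `Werner2009_lemma62` (`KestenRelationRusso.lean`;
W. Werner, *Lectures on two-dimensional critical percolation*, IAS/Park City Math. Ser. 16 (2009),
Lecture 6, Lemma 6.2 read for the rhombus `[0, N]²` as in P. Nolin, *Near-critical percolation in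
two dimensions*, EJP 13 (2008), §7.3, proof of Prop. 34, last display, and Remark 35
[arXiv 0711.4948: Prop. 32, Remark 34]: `Σ_{x ∈ [0,N]²} P_t(x pivotal for 𝒞_H([0,N]²)) ≍ N² π₄(N)`
uniformly for `t` near `1/2` and `N ≤ L_ε(t)`), after `KestenRelationRussoProofs.lean` (symmetry
`t ↔ 1 - t`), `RhombusPivotalSumBounds.lean` (upper bound from the order-free facts),
`RhombusPivotalSumWerner.lean` (Lemma 6.3 by integration along the rhombus) and
`RhombusPivotalFromSeparation.lean` (`Werner2009_lemma62_of_separation`: the fact from ONE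
hypothesis, near-critical separation of the ORDER-FREE four-arm event).

## Why this file

Werner's `π̂_p(r₁, r₂)` (Lecture 5, §3; Lecture 6, §4) — like Kesten's (1987, (1.12)) and Nolin's
(`σ = BWBW`) four-arm events — is the probability of four arms in ALTERNATING cyclic order, the
pattern produced by a pivotal site ("four arms of alternating colors starting from its
neighbors", proof of Lemma 6.2), whereas the tree's `fourArmProbAt t r R = P_t(armEvent ![T,F,T,F] r R)`
and `π₄ = critFourArmProb` (the right-hand side of `Werner2009_lemma62`) do not prescribe the
cyclic order (`ArmEvents.lean`, design note; `AltFourArm.lean`; `ArmPatternsFourArm.lean`: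
`armEvent ![T,F,T,F] = altFourArm ∪ adjFourArm`). The near-critical arm calculus of the tree is
now developed, as in the literature, for the alternating pattern in cluster form
(`altFourArm`, `altFourArmProbAt`; `NearCriticalOneArmFromAltFacts.lean`,
`FourArmStabilityFromAltPattern.lean`, `WernerKestenRelationAlt.lean`,
`WernerPivotalEstimatesAlt.lean`), the separation hypothesis being consumed in the alternating
form

  `(hsepA)  c · π̂^alt_t(n, N) ≤ P_t(sepFourArm n N)`  for `n₀ ≤ n`, `2n ≤ N ≤ L(t, ε)`, `t ∈ [1/2, 1/2 + δ)`

(Nolin 2008, Thm. 11 for `j = 4`, `σ = BWBW` [arXiv Thm. 10]; Werner 2009, Prop. 6.1). This file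
brings `Werner2009_lemma62` to the same footing:

* `relabel_shift_mem_altFourArm_of_isPivotal`, `measureReal_isPivotal_triLRCrossing_le_altFourArmProbAt`
  — **a pivotal site of `LR(m, n)` at distance `≥ d` from the sides carries four ALTERNATING
  arms in cluster form**, `ω - v ∈ altFourArm 1 d`, hence
  `P_t(v pivotal for LR(m, n)) ≤ π̂^alt_t(r₀, d)` (`1 ≤ r₀ ≤ d`): the argument of
  `relabel_shift_mem_armEvent_of_isPivotal` (`ParaPivotalArms.lean`; Werner 2009, proof of
  Lemma 6.2; Nolin 2008, §6.2, Fig. 8) with the two cluster-form clauses — an open path of the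
  annulus joining the two open half-arms would let the open crossing bypass `v` (contradicting
  pivotality), a closed one joining the two closed half-arms would, with the closed top–bottom
  crossing of `ω \ {v}`, cross `ω ∪ {v}` from top to bottom by closed sites, which the
  exclusivity half of the Hex lemma (`tri_hex_excl`) forbids in presence of the open left–right
  crossing of `ω ∪ {v}` (the same contradictions that make the half-arms disjoint). General
  `m, n`: it serves the parallelogram `R(2N, N)` of `Werner2009_lemma62P/W` as well as the rhombus.
* `rhombus_pivotal_lowerBound_of_separation_gen` — the interior pivotal lower bound for the
  rhombus from separation, **for any four-arm kernel `Q_t(r, R)` antitone in `R`** with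
  `c · Q_t(n, N) ≤ P_t(sepFourArm n N)` below `L(t, ε)` (the proof of
  `rhombus_pivotal_lowerBound_of_separation`, which used the order-free `π̂` only through these
  two properties); instances `rhombus_pivotal_lowerBound_of_altSeparation` (`Q = π̂^alt`) and
  the counting `rhombusPivotalSum_lower_of_pointwise_gen`,
  **`rhombusPivotalSum_lower_alt_of_altSeparation`**: `c N² π̂^alt_t(r₀, N) ≤ Σ_x P_t(x pivotal)`
  for `1/2 ≤ t < 1/2 + δ`, `n₁ ≤ N ≤ L(t, ε)` — the LOWER half of Werner's Lemma 6.2 for the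
  rhombus exactly as printed (alternating `π̂_p`), from his Prop. 6.1 as printed.
* Assemblies (all hypotheses displayed `∀∃` statements, D-0026):
  - `Werner2009_lemma62_of_altSeparation_of_bridge` — **the fact from `(hsepA)` and the
    near-critical bridge `(Br)`** `c · π̂_t(n, N) ≤ π̂^alt_t(n, N)` below `L(t, ε)` (Nolin 2008,
    Prop. 20 with Thm. 27 for both arrangements): `Werner2009_lemma62_of_separation` with the
    composition `fourArm_nearCritical_separation_of_alt_of_bridge` of
    `FourArmStabilityFromAltPattern.lean` (restated privately, to keep the imports light), the
    same two inputs as `Werner2009_lemma62P/lemma63/kestenRelationW/prop34_of_altSeparation_of_bridge`;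
  - `Werner2009_lemma62_of_altPivotal_of_fixedRadiusBridge` — **the fact from the alternating
    pivotal count and the fixed-radius CRITICAL bridge**: IF
    `c N² P_{1/2}(altFourArm r₀ N) ≤ Σ_x P_t(x pivotal for 𝒞_H([0,N]²)) ≤ C N² P_{1/2}(altFourArm r₀ N)`
    for `1/2 ≤ t < 1/2 + δ`, `n₁ ≤ N ≤ L(t, ε)` (Nolin's Remark 35 display as printed, his `π₄`
    being the alternating one, at Werner's length) AND `π₄(r₀, N) ≤ C(r₀) P_{1/2}(altFourArm r₀ N)`
    for `N ≥ n₁(r₀)` (Nolin 2008, Prop. 20 for `j = 4` at a fixed inner radius; the hypothesis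
    `hB` of `WernerKestenRelationAlt.lean`), THEN `Werner2009_lemma62` — so the content of the
    vendored statement beyond the printed display is exactly the comparison of the two
    arrangements at `p = 1/2`, needed for the lower bound only (the upper bound uses
    `altFourArm ⊆ armEvent`);
  - `altRhombusPivotal_of_altLemma62_of_altLemma63`, `Werner2009_lemma62_of_alt`,
    `Werner2009_lemma62_of_alt_of_bridge` — the composite from Lemma 6.2 (rhombus) and Lemma 6.3
    for the alternating `π̂`, and the fact from these two and the (fixed-radius or uniform)
    critical bridge, the rhombus twins of `altPivotal_of_altLemma62P_of_altLemma63`,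
    `Werner2009_lemma62W_of_alt`;
  - `Werner2009_lemma62_of_altSeparation_of_altUpper_of_altStability` — with the lower half of
    the alternating Lemma 6.2 supplied by `(hsepA)`: what `Werner2009_lemma62` needs beyond
    alternating separation is the alternating UPPER pivotal bound (Werner's proof of Lemma 6.2,
    upper half, whose four-arm input is the ratio bound from Cor. 6.2 and §3), the alternating
    Lemma 6.3 (Nolin's Thm. 27 for `σ = BWBW`) and Prop. 20 at `p = 1/2`.

## References

* W. Werner, *Lectures on two-dimensional critical percolation*, IAS/Park City Math. Ser. 16
  (2009), Lecture 5 §3 (`π̂₄`), Lecture 6 §4 (Prop. 6.1, Cor. 6.2), §5 (Lemma 6.2 and its proof,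
  Lemma 6.3) [arXiv 0710.0856, pp. 38, 44–48] [WernerPCMI2009].
* P. Nolin, Near-critical percolation in two dimensions, *Electron. J. Probab.* 13 (2008)
  1562–1623, §4.1 (`A_{j,σ}`), Thm. 11, Prop. 12, Lemma 13, §5.1 Prop. 20, §6 Thm. 27 and Fig. 8,
  §7.3 Prop. 34 (proof, last display) and Remark 35 (arXiv 0711.4948: Thm. 10, Prop. 11,
  Lemma 12, Prop. 19, Thm. 26, Prop. 32, Remark 34) [Nolin2008].
* H. Kesten, Scaling relations for 2D-percolation, *Comm. Math. Phys.* 109 (1987) 109–156,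
  §1 (1.12), Lemmas 4–6, 8 [KestenScalingCMP1987].
* B. Bollobás, O. Riordan, *Percolation*, CUP (2006), Ch. 5, Lemma 7 (Hex lemma)
  [BollobasRiordan2006].

Tree: `altFourArm`, `altFourArmProbAt`, `altFourArm_mono_left`, `altFourArmProbAt_anti`,
`altFourArmProbAt_nonneg`, `altFourArmProbAt_le_fourArmProbAt`, `triAnn`, `mem_triAnn`
(`AltFourArm.lean`), `mem_altFourArm_of_pathIn` (`CutPointAltArms.lean`), `altFourArmProbAt_half`
(`ArmPatternsFourArm.lean`), `Werner2009_lemma62_of_separation`,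
`isPivotal_rhombus_of_glue`, `real_pivEvent_ge`, `pivHalfGlue`, `real_pivFrameEvent_ge`
(`RhombusPivotalFromSeparation.lean`, `PivotalLowerBoundFromSeparation.lean`),
`Werner2009_lemma62_of_half_le` (`KestenRelationRussoProofs.lean`),
`rhombusPivotalSum_lower_of_forall`, `charLength_le_charLengthW_of_le`
(`RhombusPivotalSumBounds.lean`), `isPivotal_iff_insert_mem_and_notMem`, `PathIn.split_at`,
`PathIn.exists_trunc_arm`, `inter_insert_diff_subset`, `inter_compl_diff_diff_subset`
(`ParaPivotalArms.lean`), `tri_hex_excl`, `triLRCrossing_or_compl_triTBCrossing`,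
`pathIn_map_iso`, `PathIn.exists_support`, `triShiftIso`, `sitePercolation_real_preimage_relabel`.
-/

noncomputable section

open MeasureTheory Set
open scoped unitInterval

namespace Literature.Probability.Percolation

open LatticeModels

/-! ### Pivotal sites of a parallelogram crossing carry four alternating arms in cluster form -/

section Arms

variable {m n d : ℕ} {v : Site 2} {ω : SiteConfig (Site 2)}

/-- **Pivotal ⇒ four alternating arms locally, cluster form** (Werner 2009, Lecture 6, proof of
Lemma 6.2: a pivotal site has "four arms of alternating colors starting from its neighbors";
Nolin 2008, §6.2, Fig. 8; Kesten 1987, Lemma 8). If `v` is pivotal for `LR(m, n)` in `ω` and the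
four sides of `R(m, n)` are at lattice distance at least `d ≥ 1` from `v`, then the configuration
seen from `v` lies in `altFourArm 1 d` (`AltFourArm.lean`): four pairwise disjoint arms
open/closed/open/closed from `∂Λ₁` to `∂Λ_d`, the two open ones not joined by an open path of the
annulus `{1 ≤ |·| ≤ d}`, the two closed ones not joined by a closed path of it. The arms are
those of `relabel_shift_mem_armEvent_of_isPivotal` (`ParaPivotalArms.lean`); the open clause holds
because a joining open path, back in `R(m, n) \ {v}` (the annulus about `v` lies inside
`R(m, n)`), would let the open left–right crossing of `ω ∪ {v}` bypass `v`, so that `ω \ {v}`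
would be crossed; the closed clause because a joining closed path would complete the two closed
half-arms into a closed top–bottom crossing of `ω ∪ {v}`, excluded by the open left–right
crossing of `ω ∪ {v}` (Hex lemma, exclusivity, `tri_hex_excl`). [cite: WernerPCMI2009, Lecture 6, proof of Lemma 6.2] [cite: Nolin2008, §6.2, proof of Thm. 27, Fig. 8 and §4.1 (σ = BWBW) (arXiv 0711.4948: Thm. 26)] [cite: BollobasRiordan2006, Ch. 5 Lemma 7] -/
theorem relabel_shift_mem_altFourArm_of_isPivotal (hd : 1 ≤ d) (h0 : (d : ℤ) ≤ v 0)
    (h0' : v 0 + d ≤ m) (h1 : (d : ℤ) ≤ v 1) (h1' : v 1 + d ≤ n)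
    (hpiv : IsPivotal (triLRCrossing m n) v ω) :
    SiteConfig.relabel (triShiftIso (-v)).toEquiv ω ∈ altFourArm 1 d := by
  classical
  set R : Set (Site 2) := ↑(rectangle m n) with hRdef
  have hpiv' := hpiv
  rw [isPivotal_iff_insert_mem_and_notMem (isUpperSet_triLRCrossing m n)] at hpiv'
  obtain ⟨⟨x, hx, y, hy, hconn⟩, hnot⟩ := hpiv'
  have hopen : PathIn triGraph (R ∩ insert v ω) x y := PathIn.of_mem_siteConnIn hconn
  have hTB : (ω \ {v})ᶜ ∈ triTBCrossing m n :=
    (triLRCrossing_or_compl_triTBCrossing m n (ω \ {v})).resolve_left hnot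
  obtain ⟨x', hx', y', hy', hconn'⟩ := hTB
  have hclosed : PathIn triGraph (R ∩ (ω \ {v})ᶜ) x' y' := PathIn.of_mem_siteConnIn hconn'
  -- coordinates of the endpoints
  have hx0 : x 0 = 0 := (Finset.mem_filter.1 hx).2
  have hy0 : y 0 = m := (Finset.mem_filter.1 hy).2
  have hx'1 : x' 1 = 0 := (Finset.mem_filter.1 hx').2
  have hy'1 : y' 1 = n := (Finset.mem_filter.1 hy').2
  have hxv : x ≠ v := by intro h; rw [h] at hx0; omega
  have hyv : y ≠ v := by intro h; rw [h] at hy0; omega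
  have hx'v : x' ≠ v := by intro h; rw [h] at hx'1; omega
  have hy'v : y' ≠ v := by intro h; rw [h] at hy'1; omega
  -- both crossings pass through `v`
  rcases hopen.split_at v with havoid | ⟨hP, hS⟩
  · exact absurd ⟨x, hx, y, hy, (havoid.mono (inter_insert_diff_subset R v ω)).mem_siteConnIn⟩ hnot
  rcases hclosed.split_at v with havoid' | ⟨hP', hS'⟩
  · exact (tri_hex_excl m n (insert v ω) hx hy hopen hx' hy'
      (havoid'.mono (inter_compl_diff_diff_subset R v ω))).elim
  obtain ⟨a₁, ha₁, hp₁⟩ := hP.resolve_left hxv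
  obtain ⟨a₂, ha₂, hp₂⟩ := hS.resolve_left hyv
  obtain ⟨a₃, ha₃, hp₃⟩ := hP'.resolve_left hx'v
  obtain ⟨a₄, ha₄, hp₄⟩ := hS'.resolve_left hy'v
  -- tight supports
  obtain ⟨S₁, hS₁, hq₁, hall₁⟩ := hp₁.exists_support
  obtain ⟨S₂, hS₂, hq₂, hall₂⟩ := hp₂.exists_support
  obtain ⟨S₃, hS₃, hq₃, hall₃⟩ := hp₃.exists_support
  obtain ⟨S₄, hS₄, hq₄, hall₄⟩ := hp₄.exists_support
  -- the open half-arms are disjoint, and so are the closed ones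
  have h12 : Disjoint S₁ S₂ := by
    rw [Set.disjoint_left]
    intro z hz₁ hz₂
    have q : PathIn triGraph ((R ∩ insert v ω) \ {v}) x y :=
      ((hall₁ z hz₁).mono hS₁).trans ((hall₂ z hz₂).mono hS₂).symm
    exact hnot ⟨x, hx, y, hy, (q.mono (inter_insert_diff_subset R v ω)).mem_siteConnIn⟩
  have h34 : Disjoint S₃ S₄ := by
    rw [Set.disjoint_left]
    intro z hz₃ hz₄
    have q : PathIn triGraph ((R ∩ (ω \ {v})ᶜ) \ {v}) x' y' :=
      ((hall₃ z hz₃).mono hS₃).trans ((hall₄ z hz₄).mono hS₄).symm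
    exact tri_hex_excl m n (insert v ω) hx hy hopen hx' hy'
      (q.mono (inter_compl_diff_diff_subset R v ω))
  -- colours and avoidance of `v`
  have hS₁v : S₁ ⊆ {v}ᶜ := fun z hz => (hS₁ hz).2
  have hS₂v : S₂ ⊆ {v}ᶜ := fun z hz => (hS₂ hz).2
  have hS₃v : S₃ ⊆ {v}ᶜ := fun z hz => (hS₃ hz).2
  have hS₄v : S₄ ⊆ {v}ᶜ := fun z hz => (hS₄ hz).2
  have hS₁ω : ∀ z ∈ S₁, z ∈ ω := fun z hz => (inter_insert_diff_subset R v ω (hS₁ hz)).2.1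
  have hS₂ω : ∀ z ∈ S₂, z ∈ ω := fun z hz => (inter_insert_diff_subset R v ω (hS₂ hz)).2.1
  have hS₃ω : ∀ z ∈ S₃, z ∉ ω := fun z hz h =>
    (inter_compl_diff_diff_subset R v ω (hS₃ hz)).2 (mem_insert_of_mem _ h)
  have hS₄ω : ∀ z ∈ S₄, z ∉ ω := fun z hz h =>
    (inter_compl_diff_diff_subset R v ω (hS₄ hz)).2 (mem_insert_of_mem _ h)
  -- the far endpoints are at distance `≥ d` from `v`
  have hdx : (d : ℤ) ≤ triNorm (x - v) := by
    have : (d : ℤ) ≤ |(x - v) 0| := by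
      simp only [Pi.sub_apply, hx0, zero_sub, abs_neg]; exact le_abs.2 (Or.inl h0)
    exact this.trans (le_max_left _ _)
  have hdy : (d : ℤ) ≤ triNorm (y - v) := by
    have : (d : ℤ) ≤ |(y - v) 0| := by simp only [Pi.sub_apply, hy0]; exact le_abs.2 (Or.inl (by omega))
    exact this.trans (le_max_left _ _)
  have hdx' : (d : ℤ) ≤ triNorm (x' - v) := by
    have : (d : ℤ) ≤ |(x' - v) 1| := by
      simp only [Pi.sub_apply, hx'1, zero_sub, abs_neg]; exact le_abs.2 (Or.inl h1)
    exact this.trans ((le_max_left _ _).trans (le_max_right _ _))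
  have hdy' : (d : ℤ) ≤ triNorm (y' - v) := by
    have : (d : ℤ) ≤ |(y' - v) 1| := by simp only [Pi.sub_apply, hy'1]; exact le_abs.2 (Or.inl (by omega))
    exact this.trans ((le_max_left _ _).trans (le_max_right _ _))
  -- truncate the four half-arms (reversed, so that they start next to `v`)
  obtain ⟨b₁, hb₁, ht₁⟩ := hq₁.symm.exists_trunc_arm ha₁ hd hdx
  obtain ⟨b₂, hb₂, ht₂⟩ := hq₂.symm.exists_trunc_arm ha₂ hd hdy
  obtain ⟨b₃, hb₃, ht₃⟩ := hq₃.symm.exists_trunc_arm ha₃ hd hdx'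
  obtain ⟨b₄, hb₄, ht₄⟩ := hq₄.symm.exists_trunc_arm ha₄ hd hdy'
  -- translate by `-v`
  set φ := triShiftIso (-v) with hφ
  have hφapp : ∀ w, φ w = w - v := fun w => by simp [hφ, sub_eq_add_neg]
  have himage : ∀ (T : Set (Site 2)) (w : Site 2), w ∈ φ '' T ↔ w + v ∈ T := by
    intro T w
    constructor
    · rintro ⟨w', hw', rfl⟩; rw [hφapp]; simpa using hw'
    · intro hw; exact ⟨w + v, hw, by rw [hφapp]; simp⟩
  have hmemω : ∀ w, w ∈ SiteConfig.relabel φ.toEquiv ω ↔ w + v ∈ ω := by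
    intro w
    rw [SiteConfig.mem_relabel_iff]
    have : φ.toEquiv.symm w = w + v := by
      apply φ.toEquiv.injective
      rw [Equiv.apply_symm_apply]
      show w = φ (w + v)
      rw [hφapp]; simp
    rw [this]
  -- the annulus `{1 ≤ |·| ≤ d}` about `0`, translated back by `+ v`, lies in `R(m, n) \ {v}`
  have hballR : ∀ w : Site 2, triNorm w ≤ d → w + v ∈ R := by
    intro w hw
    obtain ⟨hw0, hw1, -⟩ := triNorm_le_iff.1 hw
    obtain ⟨hw0a, hw0b⟩ := abs_le.1 hw0
    obtain ⟨hw1a, hw1b⟩ := abs_le.1 hw1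
    rw [hRdef, Finset.mem_coe, mem_rectangle_iff]
    simp only [Pi.add_apply]
    omega
  have hannv : ∀ w : Site 2, ((1 : ℕ) : ℤ) ≤ triNorm w → w + v ≠ v := by
    intro w hw h
    have hw0 : w = 0 := by simpa using h
    have : triNorm (0 : Site 2) = 0 := by simp [triNorm]
    rw [hw0, this] at hw
    norm_num at hw
  -- pulling paths of the annulus about `0` back to `R(m, n) \ {v}` about `v`
  have pullO : ∀ {u u' : Site 2},
      PathIn triGraph (triAnn 1 d ∩ SiteConfig.relabel φ.toEquiv ω) u u' →
        PathIn triGraph ((R ∩ insert v ω) \ {v}) (u + v) (u' + v) := by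
    intro u u' hp
    have hq := pathIn_map_iso (triShiftIso v) hp
    have e1 : (triShiftIso v) u = u + v := rfl
    have e2 : (triShiftIso v) u' = u' + v := rfl
    rw [e1, e2] at hq
    refine hq.mono ?_
    rintro z ⟨w, ⟨hwA, hwω⟩, rfl⟩
    show w + v ∈ (R ∩ insert v ω) \ {v}
    rw [mem_triAnn] at hwA
    rw [hmemω] at hwω
    exact ⟨⟨hballR w hwA.2, mem_insert_of_mem _ hwω⟩, hannv w hwA.1⟩
  have pullC : ∀ {u u' : Site 2},
      PathIn triGraph (triAnn 1 d \ SiteConfig.relabel φ.toEquiv ω) u u' →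
        PathIn triGraph ((R ∩ (ω \ {v})ᶜ) \ {v}) (u + v) (u' + v) := by
    intro u u' hp
    have hq := pathIn_map_iso (triShiftIso v) hp
    have e1 : (triShiftIso v) u = u + v := rfl
    have e2 : (triShiftIso v) u' = u' + v := rfl
    rw [e1, e2] at hq
    refine hq.mono ?_
    rintro z ⟨w, ⟨hwA, hwω⟩, rfl⟩
    show w + v ∈ (R ∩ (ω \ {v})ᶜ) \ {v}
    rw [mem_triAnn] at hwA
    rw [hmemω] at hwω
    exact ⟨⟨hballR w hwA.2, fun h => hwω h.1⟩, hannv w hwA.1⟩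
  -- the four translated supports
  let T : Fin 4 → Set (Site 2) :=
    ![φ '' (S₁ ∩ {w | triNorm (w - v) ≤ d}), φ '' (S₃ ∩ {w | triNorm (w - v) ≤ d}),
      φ '' (S₂ ∩ {w | triNorm (w - v) ≤ d}), φ '' (S₄ ∩ {w | triNorm (w - v) ≤ d})]
  -- colours of the translated supports
  have hcolT : ∀ i, ∀ z ∈ T i, (z ∈ SiteConfig.relabel φ.toEquiv ω ↔ (![true, false, true, false] : Fin 4 → Bool) i = true) := by
    intro i z hz
    rw [hmemω]
    fin_cases i
    · change z ∈ φ '' (S₁ ∩ {w | triNorm (w - v) ≤ d}) at hz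
      rw [himage] at hz; simpa using hS₁ω _ hz.1
    · change z ∈ φ '' (S₃ ∩ {w | triNorm (w - v) ≤ d}) at hz
      rw [himage] at hz; simpa using hS₃ω _ hz.1
    · change z ∈ φ '' (S₂ ∩ {w | triNorm (w - v) ≤ d}) at hz
      rw [himage] at hz; simpa using hS₂ω _ hz.1
    · change z ∈ φ '' (S₄ ∩ {w | triNorm (w - v) ≤ d}) at hz
      rw [himage] at hz; simpa using hS₄ω _ hz.1
  refine mem_altFourArm_of_pathIn T ?_ hcolT ?_ ?_ ?_ ?_
  · -- pairwise disjointness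
    have key : ∀ {A B : Set (Site 2)}, (∀ z ∈ A, ∀ z' ∈ B, z ≠ z') →
        Disjoint (φ '' (A ∩ {w | triNorm (w - v) ≤ d})) (φ '' (B ∩ {w | triNorm (w - v) ≤ d})) := by
      intro A B hAB
      rw [Set.disjoint_left]
      intro z hzA hzB
      rw [himage] at hzA hzB
      exact hAB _ hzA.1 _ hzB.1 rfl
    have oc : ∀ {A B : Set (Site 2)}, (∀ z ∈ A, z ∈ ω) → (∀ z ∈ B, z ∉ ω) → ∀ z ∈ A, ∀ z' ∈ B, z ≠ z' := by
      intro A B hA hB z hz z' hz' hzz'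
      exact hB z' hz' (hzz' ▸ hA z hz)
    have co : ∀ {A B : Set (Site 2)}, (∀ z ∈ A, z ∉ ω) → (∀ z ∈ B, z ∈ ω) → ∀ z ∈ A, ∀ z' ∈ B, z ≠ z' := by
      intro A B hA hB z hz z' hz' hzz'
      exact hA z hz (hzz' ▸ hB z' hz')
    have d12 : ∀ z ∈ S₁, ∀ z' ∈ S₂, z ≠ z' := fun z hz z' hz' hzz' =>
      Set.disjoint_left.1 h12 hz (hzz' ▸ hz')
    have d34 : ∀ z ∈ S₃, ∀ z' ∈ S₄, z ≠ z' := fun z hz z' hz' hzz' =>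
      Set.disjoint_left.1 h34 hz (hzz' ▸ hz')
    intro i j hij
    fin_cases i <;> fin_cases j
    · exact absurd rfl hij
    · exact key (oc hS₁ω hS₃ω)
    · exact key d12
    · exact key (oc hS₁ω hS₄ω)
    · exact key (co hS₃ω hS₁ω)
    · exact absurd rfl hij
    · exact key (co hS₃ω hS₂ω)
    · exact key d34
    · exact key fun z hz z' hz' hzz' => d12 z' hz' z hz hzz'.symm
    · exact key (oc hS₂ω hS₃ω)
    · exact absurd rfl hij
    · exact key (oc hS₂ω hS₄ω)
    · exact key (co hS₄ω hS₁ω)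
    · exact key fun z hz z' hz' hzz' => d34 z' hz' z hz hzz'.symm
    · exact key (co hS₄ω hS₂ω)
    · exact absurd rfl hij
  · -- the supports lie in the annulus `{1 ≤ |·| ≤ d}`
    have key : ∀ {A : Set (Site 2)}, A ⊆ {v}ᶜ → ∀ z ∈ φ '' (A ∩ {w | triNorm (w - v) ≤ d}),
        ((1 : ℕ) : ℤ) ≤ triNorm z ∧ triNorm z ≤ d := by
      intro A hA z hz
      rw [himage] at hz
      obtain ⟨hzA, hzd⟩ := hz
      have e : z + v - v = z := by simp
      refine ⟨?_, ?_⟩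
      · have := one_le_triNorm_sub_of_ne (hA hzA); rw [e] at this; exact_mod_cast this
      · have : triNorm (z + v - v) ≤ d := hzd
        rwa [e] at this
    intro i
    fin_cases i
    · exact key hS₁v
    · exact key hS₃v
    · exact key hS₂v
    · exact key hS₄v
  · -- each support contains an arm from `∂Λ₁` to `∂Λ_d`
    have key : ∀ {A : Set (Site 2)} {a b : Site 2}, triGraph.Adj a v → triNorm (b - v) = d →
        PathIn triGraph (A ∩ {w | triNorm (w - v) ≤ d}) a b →
        ∃ x ∈ triSphere 1, ∃ y ∈ triSphere d, PathIn triGraph (φ '' (A ∩ {w | triNorm (w - v) ≤ d})) x y := by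
      intro A a b hav hb hp
      refine ⟨φ a, ?_, φ b, ?_, pathIn_map_iso φ hp⟩
      · rw [mem_triSphere_iff, hφapp]; exact_mod_cast triNorm_sub_eq_one_of_adj hav
      · rw [mem_triSphere_iff, hφapp, hb]
    intro i
    fin_cases i
    · exact key ha₁ hb₁ ht₁
    · exact key ha₃ hb₃ ht₃
    · exact key ha₂ hb₂ ht₂
    · exact key ha₄ hb₄ ht₄
  · -- no open path of the annulus joins the two open half-arms: the crossing would bypass `v`
    intro u hu u' hu' hp
    change u ∈ φ '' (S₁ ∩ {w | triNorm (w - v) ≤ d}) at hu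
    change u' ∈ φ '' (S₂ ∩ {w | triNorm (w - v) ≤ d}) at hu'
    rw [himage] at hu hu'
    have q : PathIn triGraph ((R ∩ insert v ω) \ {v}) x y :=
      (((hall₁ _ hu.1).mono hS₁).trans (pullO hp)).trans ((hall₂ _ hu'.1).mono hS₂).symm
    exact hnot ⟨x, hx, y, hy, (q.mono (inter_insert_diff_subset R v ω)).mem_siteConnIn⟩
  · -- no closed path of the annulus joins the two closed half-arms: Hex lemma, exclusivity
    intro u hu u' hu' hp
    change u ∈ φ '' (S₃ ∩ {w | triNorm (w - v) ≤ d}) at hu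
    change u' ∈ φ '' (S₄ ∩ {w | triNorm (w - v) ≤ d}) at hu'
    rw [himage] at hu hu'
    have q : PathIn triGraph ((R ∩ (ω \ {v})ᶜ) \ {v}) x' y' :=
      (((hall₃ _ hu.1).mono hS₃).trans (pullC hp)).trans ((hall₄ _ hu'.1).mono hS₄).symm
    exact tri_hex_excl m n (insert v ω) hx hy hopen hx' hy'
      (q.mono (inter_compl_diff_diff_subset R v ω))

/-- **The pointwise pivotal bound with Werner's alternating `π̂`** (the inner step of the upper
bound in Werner 2009, Lecture 6, Lemma 6.2, and of Nolin 2008, (7.21), with the alternating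
four-arm probability of the printed texts): for `1 ≤ r₀ ≤ d` and a site `v` at lattice distance at
least `d` from the four sides of `R(m, n)`,
`P_t(v is pivotal for LR(m, n)) ≤ π̂^alt_t(r₀, d) = altFourArmProbAt t r₀ d`, by
`relabel_shift_mem_altFourArm_of_isPivotal`, monotonicity of `altFourArm` in the inner radius and
translation invariance of `P_t`; the alternating sharpening of
`measureReal_isPivotal_triLRCrossing_le_fourArmProbAt`. [cite: WernerPCMI2009, Lecture 6, proof of Lemma 6.2] [cite: Nolin2008, §7.3, eq. (7.21) (arXiv 0711.4948: proof of Prop. 31)] -/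
theorem measureReal_isPivotal_triLRCrossing_le_altFourArmProbAt (t : unitInterval) {r₀ : ℕ}
    (hr₀ : 1 ≤ r₀) (hrd : r₀ ≤ d) (h0 : (d : ℤ) ≤ v 0) (h0' : v 0 + d ≤ m) (h1 : (d : ℤ) ≤ v 1)
    (h1' : v 1 + d ≤ n) :
    (triSitePercolation t).real {ω | IsPivotal (triLRCrossing m n) v ω} ≤ altFourArmProbAt t r₀ d := by
  have hd : 1 ≤ d := hr₀.trans hrd
  set φ := triShiftIso (-v) with hφ
  have hsub : {ω : SiteConfig (Site 2) | IsPivotal (triLRCrossing m n) v ω} ⊆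
      SiteConfig.relabel φ.toEquiv ⁻¹' altFourArm r₀ d := fun ω hω =>
    altFourArm_mono_left hr₀ hrd (relabel_shift_mem_altFourArm_of_isPivotal hd h0 h0' h1 h1' hω)
  calc (triSitePercolation t).real {ω | IsPivotal (triLRCrossing m n) v ω}
      ≤ (triSitePercolation t).real (SiteConfig.relabel φ.toEquiv ⁻¹' altFourArm r₀ d) :=
        measureReal_mono hsub
    _ = altFourArmProbAt t r₀ d := by
        rw [altFourArmProbAt, triSitePercolation]
        exact sitePercolation_real_preimage_relabel φ.toEquiv t _

end Arms

/-! ### The rhombus interior pivotal lower bound from separation, for any four-arm kernel -/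

/-- **Interior sites of the rhombus are pivotal with probability `≥ cst · Q_t(r₀, N)` below
`L(p)`, from separation stated with any kernel `Q`** (Nolin 2008, proof of Prop. 34, last display,
"by Theorem 11"; Werner 2009, proof of Lemma 6.2, lower bound): the proof of
`rhombus_pivotal_lowerBound_of_separation` (`RhombusPivotalFromSeparation.lean`) uses the four-arm
probability only through the separation hypothesis at the scales `(r₀, 64⌊N/512⌋)` and its
antitonicity in the outer radius, so it holds for every `Q : unitInterval → ℕ → ℕ → ℝ` antitone
in the outer radius with `c · Q_t(n, N) ≤ P_t(sepFourArm n N)` for `n₀ ≤ n`, `2n ≤ N ≤ L(t, ε)`,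
`t ∈ [1/2, 1/2 + δ)`: for every small `ε` and every `r₀ ≥ r₁` there are `n₁`, `δ > 0`, `c' > 0`
with `c' · Q_t(r₀, N) ≤ P_t(v is pivotal for LR(N, N))` for `n₁ ≤ N ≤ L(t, ε)` and every site
`v` with `N/4 < v₀, v₁ < 3N/4`. Instances: `Q = π̂` (order-free, the original theorem) and
`Q = π̂^alt` (`rhombus_pivotal_lowerBound_of_altSeparation`). [cite: Nolin2008, §7.3 proof of Prop. 34 (last display), Thm. 11, Prop. 12, Lemma 13 (arXiv 0711.4948: Prop. 32, Thm. 10, Prop. 11, Lemma 12)] [cite: WernerPCMI2009, Lecture 6, proof of Lemma 6.2 (lower bound), Prop. 6.1] [cite: KestenScalingCMP1987, Lemmas 4–6 and 8] -/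
theorem rhombus_pivotal_lowerBound_of_separation_gen {Q : unitInterval → ℕ → ℕ → ℝ}
    (hQanti : ∀ (t : unitInterval) (r R R' : ℕ), r ≤ R → R ≤ R' → Q t r R' ≤ Q t r R)
    (hsep : ∃ ε₁ > (0 : ℝ), ∀ ⦃ε : ℝ⦄, 0 < ε → ε < ε₁ →
      ∃ n₀ : ℕ, ∃ δ > (0 : ℝ), ∃ c > (0 : ℝ),
        ∀ t : unitInterval, 1 / 2 ≤ (t : ℝ) → (t : ℝ) < 1 / 2 + δ →
          ∀ n N : ℕ, n₀ ≤ n → 2 * n ≤ N → (1 / 2 < (t : ℝ) → N ≤ charLengthW ε t) →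
            c * Q t n N ≤ (triSitePercolation t).real (sepFourArm n N)) :
    ∃ ε₁ > (0 : ℝ), ∀ ⦃ε : ℝ⦄, 0 < ε → ε < ε₁ →
      ∃ r₁ : ℕ, ∀ r₀ ≥ r₁, ∃ n₁ : ℕ, ∃ δ > (0 : ℝ), ∃ c > (0 : ℝ),
        ∀ t : unitInterval, 1 / 2 ≤ (t : ℝ) → (t : ℝ) < 1 / 2 + δ →
          ∀ N : ℕ, n₁ ≤ N → (1 / 2 < (t : ℝ) → N ≤ charLengthW ε t) →
            ∀ v : Site 2, (N : ℤ) < 4 * v 0 → 4 * v 0 < 3 * N → (N : ℤ) < 4 * v 1 → 4 * v 1 < 3 * N →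
              c * Q t r₀ N ≤
                (triSitePercolation t).real {ω | IsPivotal (triLRCrossing N N) v ω} := by
  obtain ⟨ε₁, hε₁, H⟩ := hsep
  refine ⟨ε₁, hε₁, fun ε hε hεε₁ => ?_⟩
  obtain ⟨n₀, δs, hδs, cs, hcs, Hs⟩ := H hε hεε₁
  -- RSW below Werner's length, and at `1/2`
  obtain ⟨ε', hε', hε'2, hLen⟩ := charLengthW_le_charLength_of_gt hε
  obtain ⟨η, hη, -, hRSW⟩ := exists_pow_le_triLRCrossingProb_below hε' hε'2
  obtain ⟨c₀, hc₀, h0⟩ := tri_rsw_half_holds 2046 (by norm_num)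
  set θ : ℝ := min (η ^ 2045) c₀ with hθ
  have hθ0 : 0 < θ := lt_min (pow_pos hη _) hc₀
  refine ⟨max n₀ 64, fun r₀ hr₀ => ?_⟩
  have hr₀n : n₀ ≤ r₀ := le_trans (le_max_left _ _) hr₀
  have hr₀64 : 64 ≤ r₀ := le_trans (le_max_right _ _) hr₀
  -- the lower bound of each gluing event, and of the four of them
  set g : ℝ := (1 / 4 : ℝ) ^ (pivInnerFinset r₀).card * θ ^ 33 with hg
  have hg0 : 0 < g := by positivity
  set K : ℝ := g * g * (g * g) with hK
  have hK0 : 0 < K := by positivity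
  refine ⟨512 * (r₀ + 1), min δs (1 / 4), lt_min hδs (by norm_num), cs * K, mul_pos hcs hK0,
    fun t ht1 ht2 N hN hNL v hv0 hv0' hv1 hv1' => ?_⟩
  have htδ : (t : ℝ) < 1 / 2 + δs := lt_of_lt_of_le ht2 (by linarith [min_le_left δs (1 / 4)])
  have ht34 : (t : ℝ) < 3 / 4 := by linarith [min_le_right δs (1 / 4)]
  -- the scale `q = ⌊N / 512⌋`
  set q : ℕ := N / 512 with hq
  have hdm := Nat.div_add_mod N 512
  have hml := Nat.mod_lt N (by norm_num : 512 > 0)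
  have hqN : 512 * q ≤ N := by omega
  have hNq : N < 512 * (q + 1) := by omega
  have hq65 : r₀ + 1 ≤ q := by
    rw [hq]; exact (Nat.le_div_iff_mul_le (by norm_num)).2 (by linarith)
  have hq1 : 1 ≤ q := by omega
  have hr₀q : r₀ ≤ 64 * q := by omega
  have h2r₀ : 2 * r₀ ≤ 64 * q := by omega
  have h64N : 64 * q ≤ N := by omega
  -- the site as a pair of naturals
  obtain ⟨a, ha⟩ : ∃ a : ℕ, v 0 = a := ⟨(v 0).toNat, (Int.toNat_of_nonneg (by omega)).symm⟩
  obtain ⟨b, hb⟩ : ∃ b : ℕ, v 1 = b := ⟨(v 1).toNat, (Int.toNat_of_nonneg (by omega)).symm⟩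
  rw [ha] at hv0 hv0'
  rw [hb] at hv1 hv1'
  have ha1 : N < 4 * a := by exact_mod_cast hv0
  have ha2 : 4 * a < 3 * N := by exact_mod_cast hv0'
  have hb1 : N < 4 * b := by exact_mod_cast hv1
  have hb2 : 4 * b < 3 * N := by exact_mod_cast hv1'
  have hv : v = ![(a : ℤ), (b : ℤ)] := by
    ext j; fin_cases j
    · simpa using ha
    · simpa using hb
  subst hv
  -- the gluing event seen from `v`
  set E : Set (SiteConfig (Site 2)) :=
    sepFourArm r₀ (64 * q) ∩ (pivHalfGlue 0 true q r₀ (N - a) ∩ pivHalfGlue 3 true q r₀ a) ∩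
      (pivHalfGlue 1 false q r₀ (N - b) ∩ pivHalfGlue 4 false q r₀ b) with hE
  -- (1) the deterministic inclusion and translation invariance
  have hincl : {ω : SiteConfig (Site 2) |
      SiteConfig.relabel (triShiftIso (-(![(a : ℤ), (b : ℤ)] : Site 2))).toEquiv ω ∈ E} ⊆
      {ω | IsPivotal (triLRCrossing N N) ![(a : ℤ), (b : ℤ)] ω} :=
    fun ω hω => isPivotal_rhombus_of_glue hq1 hr₀64 hr₀q hqN ha1 ha2 hb1 hb2 hω
  have step1 : (triSitePercolation t).real E ≤
      (triSitePercolation t).real {ω | IsPivotal (triLRCrossing N N) ![(a : ℤ), (b : ℤ)] ω} := by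
    rw [← real_setOf_relabel_shift_mem t (![(a : ℤ), (b : ℤ)]) E]
    exact measureReal_mono hincl (measure_ne_top _ _)
  -- (2) Nolin's Lemma 13
  have step2 := real_pivEvent_ge t hq1 hr₀64 hr₀q (N - a) a (N - b) b
  -- (3) the gluing events
  have hquarter : ∀ p : unitInterval, (p = t ∨ p = σ t) → (1 / 4 : ℝ) ≤ p := by
    rintro p (rfl | rfl)
    · linarith
    · rw [unitInterval.coe_symm_eq]; linarith
  have hslab : ∀ D : ℕ, D ≤ 2 * N → ∀ p : unitInterval, (p = t ∨ p = σ t) → ∀ k : ℕ, k < 33 →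
      θ ≤ (triSitePercolation p).real (triHCross (64 * (q : ℤ) + 1) ((-48 + (k : ℤ)) * q) D q) := by
    intro D hD p hp k _
    rw [triSitePercolation_real_triHCross]
    have hDq : D ≤ 2046 * q := by omega
    have hanti : triLRCrossingProb p (2046 * q) q ≤ triLRCrossingProb p D q :=
      triLRCrossingProb_anti_width p hDq q
    refine le_trans ?_ hanti
    rcases eq_or_lt_of_le ht1 with heq | hgt
    · -- `t = 1/2`
      have ht : t = half := Subtype.ext (by rw [coe_half]; exact heq.symm)
      have hp' : p = half := by
        rcases hp with rfl | rfl
        · exact ht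
        · rw [ht, symm_half]
      have hfl : ⌊(2046 : ℝ) * q⌋₊ = 2046 * q := by
        have : (2046 : ℝ) * q = ((2046 * q : ℕ) : ℝ) := by push_cast; ring
        rw [this, Nat.floor_natCast]
      have := (h0 q (by rw [hfl]; omega)).1
      rw [hfl] at this
      rw [hp']
      exact (min_le_right _ _).trans this
    · -- `t > 1/2`: below Nolin's length
      have hqL : q < charLength ε' t :=
        lt_of_lt_of_le (by omega : q < N) ((hNL hgt).trans (hLen t hgt ht34))
      have hpmin : min t (σ t) ≤ p := by
        rcases hp with rfl | rfl
        · exact min_le_left _ _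
        · exact min_le_right _ _
      have := hRSW t p hpmin q hq1 hqL 2045 (2046 * q) (by norm_num) (by omega)
      exact (min_le_left _ _).trans this
  have hglue : ∀ D : ℕ, D ≤ 2 * N → ∀ p : unitInterval, (p = t ∨ p = σ t) →
      g ≤ (triSitePercolation p).real (pivFrameEvent q r₀ D) := by
    intro D hD p hp
    calc g = (1 / 4 : ℝ) ^ (pivInnerFinset r₀).card * θ ^ 33 := rfl
      _ ≤ (p : ℝ) ^ (pivInnerFinset r₀).card * θ ^ 33 :=
          mul_le_mul_of_nonneg_right (pow_le_pow_left₀ (by norm_num) (hquarter p hp) _) (by positivity)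
      _ ≤ _ := real_pivFrameEvent_ge p r₀ hθ0.le (hslab D hD p hp)
  have g0 : g ≤ (triSitePercolation t).real (pivHalfGlue 0 true q r₀ (N - a)) := by
    rw [real_pivHalfGlue_true]; exact hglue _ (by omega) t (Or.inl rfl)
  have g3 : g ≤ (triSitePercolation t).real (pivHalfGlue 3 true q r₀ a) := by
    rw [real_pivHalfGlue_true]; exact hglue _ (by omega) t (Or.inl rfl)
  have g1 : g ≤ (triSitePercolation t).real (pivHalfGlue 1 false q r₀ (N - b)) := by
    rw [real_pivHalfGlue_false]; exact hglue _ (by omega) (σ t) (Or.inr rfl)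
  have g4 : g ≤ (triSitePercolation t).real (pivHalfGlue 4 false q r₀ b) := by
    rw [real_pivHalfGlue_false]; exact hglue _ (by omega) (σ t) (Or.inr rfl)
  have hKle : K ≤ ((triSitePercolation t).real (pivHalfGlue 0 true q r₀ (N - a)) *
        (triSitePercolation t).real (pivHalfGlue 3 true q r₀ a)) *
      ((triSitePercolation t).real (pivHalfGlue 1 false q r₀ (N - b)) *
        (triSitePercolation t).real (pivHalfGlue 4 false q r₀ b)) :=
    mul_le_mul (mul_le_mul g0 g3 hg0.le measureReal_nonneg) (mul_le_mul g1 g4 hg0.le measureReal_nonneg)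
      (by positivity) (mul_nonneg measureReal_nonneg measureReal_nonneg)
  -- (4) separation at the scales `(r₀, 64q)` and antitonicity in the outer radius
  have hsepb := Hs t ht1 htδ r₀ (64 * q) hr₀n h2r₀ (fun hgt => le_trans h64N (hNL hgt))
  have hmono : Q t r₀ N ≤ Q t r₀ (64 * q) := hQanti t r₀ (64 * q) N hr₀q h64N
  -- (5) the chain
  calc cs * K * Q t r₀ N
      ≤ cs * K * Q t r₀ (64 * q) := mul_le_mul_of_nonneg_left hmono (by positivity)
    _ = cs * Q t r₀ (64 * q) * K := by ring
    _ ≤ (triSitePercolation t).real (sepFourArm r₀ (64 * q)) * K :=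
        mul_le_mul_of_nonneg_right hsepb hK0.le
    _ ≤ (triSitePercolation t).real (sepFourArm r₀ (64 * q)) *
          (((triSitePercolation t).real (pivHalfGlue 0 true q r₀ (N - a)) *
              (triSitePercolation t).real (pivHalfGlue 3 true q r₀ a)) *
            ((triSitePercolation t).real (pivHalfGlue 1 false q r₀ (N - b)) *
              (triSitePercolation t).real (pivHalfGlue 4 false q r₀ b))) :=
        mul_le_mul_of_nonneg_left hKle measureReal_nonneg
    _ ≤ (triSitePercolation t).real E := step2
    _ ≤ _ := step1

/-- **Interior sites of the rhombus are pivotal with probability `≥ cst · π̂^alt_t(r₀, N)` below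
`L(p)`, from ALTERNATING near-critical four-arm separation** (Werner 2009, proof of Lemma 6.2,
lower bound, with his Prop. 6.1 — both for his alternating `π̂_p`; Nolin 2008, proof of Prop. 34,
last display, with Thm. 11 for `σ = BWBW`): `rhombus_pivotal_lowerBound_of_separation_gen` at
`Q = altFourArmProbAt` (`altFourArmProbAt_anti`). [cite: WernerPCMI2009, Lecture 6, proof of Lemma 6.2 (lower bound) and Prop. 6.1] [cite: Nolin2008, §7.3 proof of Prop. 34 (last display) and Thm. 11, σ = BWBW (arXiv 0711.4948: Prop. 32, Thm. 10)] -/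
theorem rhombus_pivotal_lowerBound_of_altSeparation
    (hsepA : ∃ ε₁ > (0 : ℝ), ∀ ⦃ε : ℝ⦄, 0 < ε → ε < ε₁ →
      ∃ n₀ : ℕ, ∃ δ > (0 : ℝ), ∃ c > (0 : ℝ),
        ∀ t : unitInterval, 1 / 2 ≤ (t : ℝ) → (t : ℝ) < 1 / 2 + δ →
          ∀ n N : ℕ, n₀ ≤ n → 2 * n ≤ N → (1 / 2 < (t : ℝ) → N ≤ charLengthW ε t) →
            c * altFourArmProbAt t n N ≤ (triSitePercolation t).real (sepFourArm n N)) :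
    ∃ ε₁ > (0 : ℝ), ∀ ⦃ε : ℝ⦄, 0 < ε → ε < ε₁ →
      ∃ r₁ : ℕ, ∀ r₀ ≥ r₁, ∃ n₁ : ℕ, ∃ δ > (0 : ℝ), ∃ c > (0 : ℝ),
        ∀ t : unitInterval, 1 / 2 ≤ (t : ℝ) → (t : ℝ) < 1 / 2 + δ →
          ∀ N : ℕ, n₁ ≤ N → (1 / 2 < (t : ℝ) → N ≤ charLengthW ε t) →
            ∀ v : Site 2, (N : ℤ) < 4 * v 0 → 4 * v 0 < 3 * N → (N : ℤ) < 4 * v 1 → 4 * v 1 < 3 * N →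
              c * altFourArmProbAt t r₀ N ≤
                (triSitePercolation t).real {ω | IsPivotal (triLRCrossing N N) v ω} :=
  rhombus_pivotal_lowerBound_of_separation_gen (fun t r _ _ hr hR => altFourArmProbAt_anti t r hr hR)
    hsepA

/-- Sanity check (an `example`, not a second name): at the order-free kernel `Q = fourArmProbAt`
the generic theorem gives back `rhombus_pivotal_lowerBound_of_separation`. -/
example
    (hsep : ∃ ε₁ > (0 : ℝ), ∀ ⦃ε : ℝ⦄, 0 < ε → ε < ε₁ →
      ∃ n₀ : ℕ, ∃ δ > (0 : ℝ), ∃ c > (0 : ℝ),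
        ∀ t : unitInterval, 1 / 2 ≤ (t : ℝ) → (t : ℝ) < 1 / 2 + δ →
          ∀ n N : ℕ, n₀ ≤ n → 2 * n ≤ N → (1 / 2 < (t : ℝ) → N ≤ charLengthW ε t) →
            c * fourArmProbAt t n N ≤ (triSitePercolation t).real (sepFourArm n N)) :
    ∃ ε₁ > (0 : ℝ), ∀ ⦃ε : ℝ⦄, 0 < ε → ε < ε₁ →
      ∃ r₁ : ℕ, ∀ r₀ ≥ r₁, ∃ n₁ : ℕ, ∃ δ > (0 : ℝ), ∃ c > (0 : ℝ),
        ∀ t : unitInterval, 1 / 2 ≤ (t : ℝ) → (t : ℝ) < 1 / 2 + δ →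
          ∀ N : ℕ, n₁ ≤ N → (1 / 2 < (t : ℝ) → N ≤ charLengthW ε t) →
            ∀ v : Site 2, (N : ℤ) < 4 * v 0 → 4 * v 0 < 3 * N → (N : ℤ) < 4 * v 1 → 4 * v 1 < 3 * N →
              c * fourArmProbAt t r₀ N ≤
                (triSitePercolation t).real {ω | IsPivotal (triLRCrossing N N) v ω} :=
  rhombus_pivotal_lowerBound_of_separation_gen (fun t _ _ _ hr hR => fourArmProbAt_anti t hr hR) hsep

/-! ### The lower half of Lemma 6.2 for the rhombus, for a kernel and for `π̂^alt` -/

/-- **The lower half of Lemma 6.2 for the rhombus from a pointwise interior bound, for any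
non-negative kernel** (Werner 2009, Lecture 6, proof of Lemma 6.2: "the contribution of the
`O(n²)` points `x` that are at distance more than `n/4` of the boundary … is at least `π̂_p(n)`"):
if every site `v` of `[0,N]²` with `N/4 < v₀, v₁ < 3N/4` is pivotal with probability
`≥ c Q_t(r₀, N)` (for `1/2 ≤ t < 1/2 + δ`, `n₁ ≤ N ≤ L(t, ε)`), then
`(c/64) N² Q_t(r₀, N) ≤ Σ_{x ∈ [0,N]²} P_t(x pivotal for 𝒞_H([0,N]²))` for `max n₁ 16 ≤ N`
(counting, `rhombusPivotalSum_lower_of_forall`); the kernel form of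
`rhombusPivotalSum_lowerW_of_pointwise`. [cite: WernerPCMI2009, Lecture 6, proof of Lemma 6.2 (lower bound)] [cite: Nolin2008, §7.3, proof of Prop. 34, last display (arXiv 0711.4948: Prop. 32)] -/
theorem rhombusPivotalSum_lower_of_pointwise_gen {Q : unitInterval → ℕ → ℕ → ℝ}
    (hQ0 : ∀ t r R, 0 ≤ Q t r R)
    (hP : ∃ ε₁ > (0 : ℝ), ∀ ⦃ε : ℝ⦄, 0 < ε → ε < ε₁ →
      ∃ r₁ : ℕ, ∀ r₀ ≥ r₁, ∃ n₁ : ℕ, ∃ δ > (0 : ℝ), ∃ c > (0 : ℝ),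
        ∀ t : unitInterval, 1 / 2 ≤ (t : ℝ) → (t : ℝ) < 1 / 2 + δ →
          ∀ N : ℕ, n₁ ≤ N → (1 / 2 < (t : ℝ) → N ≤ charLengthW ε t) →
            ∀ v : Site 2, (N : ℤ) < 4 * v 0 → 4 * v 0 < 3 * N → (N : ℤ) < 4 * v 1 → 4 * v 1 < 3 * N →
              c * Q t r₀ N ≤ (triSitePercolation t).real {ω | IsPivotal (triLRCrossing N N) v ω}) :
    ∃ ε₁ > (0 : ℝ), ∀ ⦃ε : ℝ⦄, 0 < ε → ε < ε₁ →
      ∃ r₁ : ℕ, ∀ r₀ ≥ r₁, ∃ n₁ : ℕ, ∃ δ > (0 : ℝ), ∃ c > (0 : ℝ),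
        ∀ t : unitInterval, 1 / 2 ≤ (t : ℝ) → (t : ℝ) < 1 / 2 + δ →
          ∀ N : ℕ, n₁ ≤ N → (1 / 2 < (t : ℝ) → N ≤ charLengthW ε t) →
            c * ((N : ℝ) ^ 2 * Q t r₀ N) ≤ rhombusPivotalSum t N := by
  obtain ⟨ε₁, hε₁, HP⟩ := hP
  refine ⟨ε₁, hε₁, fun ε hε hεlt => ?_⟩
  obtain ⟨r₁, HP⟩ := HP hε hεlt
  refine ⟨r₁, fun r₀ hr₀ => ?_⟩
  obtain ⟨n₁, δ, hδ, c, hc, HP⟩ := HP r₀ hr₀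
  refine ⟨max n₁ 16, δ, hδ, c / 64, by positivity, fun t ht1 ht2 N hN hNL => ?_⟩
  exact rhombusPivotalSum_lower_of_forall hc.le (hQ0 t r₀ N) ((le_max_right _ _).trans hN)
    (HP t ht1 ht2 N ((le_max_left _ _).trans hN) hNL)

/-- **The lower half of Werner's Lemma 6.2 for the rhombus, as printed (alternating `π̂`), from
his Prop. 6.1 as printed (alternating separation)**: for every small `ε` and every large inner
radius `r₀` there are `n₁`, `δ > 0`, `c > 0` with
`c N² π̂^alt_t(r₀, N) ≤ Σ_{x ∈ [0,N]²} P_t(x pivotal for 𝒞_H([0,N]²))` for `1/2 ≤ t < 1/2 + δ`,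
`n₁ ≤ N`, `N ≤ L(t, ε)` if `t > 1/2` — from `(hsepA)` alone
(`rhombus_pivotal_lowerBound_of_altSeparation` and counting). This is Nolin's display
`Σ_{x ∈ S_n} P(x pivotal) ≳ n² π₄(n)` (Remark 35 [arXiv Remark 34]) at the parameter `t`, his
`π₄` being the alternating four-arm probability. [cite: WernerPCMI2009, Lecture 6, Lemma 6.2 (lower bound) with Prop. 6.1] [cite: Nolin2008, §7.3, proof of Prop. 34 (last display), Remark 35, Thm. 11 (arXiv 0711.4948: Prop. 32, Remark 34, Thm. 10)] -/
theorem rhombusPivotalSum_lower_alt_of_altSeparation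
    (hsepA : ∃ ε₁ > (0 : ℝ), ∀ ⦃ε : ℝ⦄, 0 < ε → ε < ε₁ →
      ∃ n₀ : ℕ, ∃ δ > (0 : ℝ), ∃ c > (0 : ℝ),
        ∀ t : unitInterval, 1 / 2 ≤ (t : ℝ) → (t : ℝ) < 1 / 2 + δ →
          ∀ n N : ℕ, n₀ ≤ n → 2 * n ≤ N → (1 / 2 < (t : ℝ) → N ≤ charLengthW ε t) →
            c * altFourArmProbAt t n N ≤ (triSitePercolation t).real (sepFourArm n N)) :
    ∃ ε₁ > (0 : ℝ), ∀ ⦃ε : ℝ⦄, 0 < ε → ε < ε₁ →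
      ∃ r₁ : ℕ, ∀ r₀ ≥ r₁, ∃ n₁ : ℕ, ∃ δ > (0 : ℝ), ∃ c > (0 : ℝ),
        ∀ t : unitInterval, 1 / 2 ≤ (t : ℝ) → (t : ℝ) < 1 / 2 + δ →
          ∀ N : ℕ, n₁ ≤ N → (1 / 2 < (t : ℝ) → N ≤ charLengthW ε t) →
            c * ((N : ℝ) ^ 2 * altFourArmProbAt t r₀ N) ≤ rhombusPivotalSum t N :=
  rhombusPivotalSum_lower_of_pointwise_gen altFourArmProbAt_nonneg
    (rhombus_pivotal_lowerBound_of_altSeparation hsepA)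

/-! ### `Werner2009_lemma62` from alternating separation and the near-critical bridge -/

/-- Order-free near-critical separation from alternating separation and the bridge (the
composition `fourArm_nearCritical_separation_of_alt_of_bridge` of
`FourArmStabilityFromAltPattern.lean`, restated privately to keep the imports of this file light —
that file imports the whole `KestenScalingFromSeparation` cone). [cite: Nolin2008, Thm. 11, Prop. 20 and Thm. 27 (arXiv 0711.4948: Thm. 10, Prop. 19, Thm. 26)] -/
private theorem sep_of_altSep_of_bridge
    (hsepA : ∃ ε₁ > (0 : ℝ), ∀ ⦃ε : ℝ⦄, 0 < ε → ε < ε₁ →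
      ∃ n₀ : ℕ, ∃ δ > (0 : ℝ), ∃ c > (0 : ℝ),
        ∀ t : unitInterval, 1 / 2 ≤ (t : ℝ) → (t : ℝ) < 1 / 2 + δ →
          ∀ n N : ℕ, n₀ ≤ n → 2 * n ≤ N → (1 / 2 < (t : ℝ) → N ≤ charLengthW ε t) →
            c * altFourArmProbAt t n N ≤ (triSitePercolation t).real (sepFourArm n N))
    (hBr : ∃ ε₁ > (0 : ℝ), ∀ ⦃ε : ℝ⦄, 0 < ε → ε < ε₁ →
      ∃ n₀ : ℕ, ∃ δ > (0 : ℝ), ∃ c > (0 : ℝ),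
        ∀ t : unitInterval, 1 / 2 ≤ (t : ℝ) → (t : ℝ) < 1 / 2 + δ →
          ∀ n N : ℕ, n₀ ≤ n → 2 * n ≤ N → (1 / 2 < (t : ℝ) → N ≤ charLengthW ε t) →
            c * fourArmProbAt t n N ≤ altFourArmProbAt t n N) :
    ∃ ε₁ > (0 : ℝ), ∀ ⦃ε : ℝ⦄, 0 < ε → ε < ε₁ →
      ∃ n₀ : ℕ, ∃ δ > (0 : ℝ), ∃ c > (0 : ℝ),
        ∀ t : unitInterval, 1 / 2 ≤ (t : ℝ) → (t : ℝ) < 1 / 2 + δ →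
          ∀ n N : ℕ, n₀ ≤ n → 2 * n ≤ N → (1 / 2 < (t : ℝ) → N ≤ charLengthW ε t) →
            c * fourArmProbAt t n N ≤ (triSitePercolation t).real (sepFourArm n N) := by
  obtain ⟨ε₁, hε₁, HA⟩ := hsepA
  obtain ⟨ε₂, hε₂, HB⟩ := hBr
  refine ⟨min ε₁ ε₂, lt_min hε₁ hε₂, fun ε hε hεε => ?_⟩
  obtain ⟨n₁, δ₁, hδ₁, c₁, hc₁, H₁⟩ := HA hε (lt_of_lt_of_le hεε (min_le_left _ _))
  obtain ⟨n₂, δ₂, hδ₂, c₂, hc₂, H₂⟩ := HB hε (lt_of_lt_of_le hεε (min_le_right _ _))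
  refine ⟨max n₁ n₂, min δ₁ δ₂, lt_min hδ₁ hδ₂, c₁ * c₂, mul_pos hc₁ hc₂,
    fun t ht ht' n N hn hnN hL => ?_⟩
  have h₁ := H₁ t ht (lt_of_lt_of_le ht' (by linarith [min_le_left δ₁ δ₂])) n N
    (le_trans (le_max_left _ _) hn) hnN hL
  have h₂ := H₂ t ht (lt_of_lt_of_le ht' (by linarith [min_le_right δ₁ δ₂])) n N
    (le_trans (le_max_right _ _) hn) hnN hL
  calc c₁ * c₂ * fourArmProbAt t n N = c₁ * (c₂ * fourArmProbAt t n N) := by ring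
    _ ≤ c₁ * altFourArmProbAt t n N := mul_le_mul_of_nonneg_left h₂ hc₁.le
    _ ≤ (triSitePercolation t).real (sepFourArm n N) := h₁

/-- Uniform bridge ⇒ fixed-radius bridge (the lemma `fixedRadiusBridge_of_bridge` of
`WernerKestenRelationAlt.lean`, restated privately so as not to import the parallelogram file). [cite: Nolin2008, §5.1 Prop. 20 (arXiv 0711.4948: Prop. 19)] -/
private theorem fixedRadius_of_bridge
    (hBr : ∃ c : ℝ, 0 < c ∧ ∃ n₀ : ℕ, ∀ n N : ℕ, n₀ ≤ n → 2 * n ≤ N →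
      c * critFourArmProb n N ≤ (triSitePercolation half).real (altFourArm n N)) :
    ∃ r₁ : ℕ, ∀ r₀ ≥ r₁, ∃ n₁ : ℕ, ∃ C : ℝ, ∀ N : ℕ, n₁ ≤ N →
      critFourArmProb r₀ N ≤ C * altFourArmProbAt half r₀ N := by
  obtain ⟨c, hc, n₀, h⟩ := hBr
  refine ⟨n₀, fun r₀ hr₀ => ⟨2 * r₀, c⁻¹, fun N hN => ?_⟩⟩
  have key := h r₀ N hr₀ hN
  show critFourArmProb r₀ N ≤ c⁻¹ * (triSitePercolation half).real (altFourArm r₀ N)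
  calc critFourArmProb r₀ N = c⁻¹ * (c * critFourArmProb r₀ N) := by
        rw [← mul_assoc, inv_mul_cancel₀ hc.ne', one_mul]
    _ ≤ c⁻¹ * (triSitePercolation half).real (altFourArm r₀ N) :=
        mul_le_mul_of_nonneg_left key (inv_pos.2 hc).le


/-- **`Werner2009_lemma62` from ALTERNATING near-critical four-arm separation and the bridge.**
IF `c · π̂^alt_t(n, N) ≤ P_t(sepFourArm n N)` for `n₀ ≤ n`, `2n ≤ N`, `N ≤ L(t, ε)` if `t > 1/2`,
`t ∈ [1/2, 1/2 + δ)` (Nolin 2008, Thm. 11 for `j = 4`, `σ = BWBW` [arXiv 0711.4948: Thm. 10];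
Werner 2009, Prop. 6.1) AND `c' · π̂_t(n, N) ≤ π̂^alt_t(n, N)` in the same regime (the comparison
of the two arrangements of the order-free event below `L(p)`: Nolin 2008, Prop. 20 with Thm. 27
for `σ = BWBW` and `σ = BBWW` [arXiv Prop. 19, Thm. 26]), THEN `Werner2009_lemma62`:
`Werner2009_lemma62_of_separation` with the composition of the two hypotheses
(`fourArm_nearCritical_separation_of_alt_of_bridge` of `FourArmStabilityFromAltPattern.lean`,
restated privately above) — the same two inputs as the other order-free facts of the cone. [cite: WernerPCMI2009, Lecture 6, Lemma 6.2 with Prop. 6.1, Cor. 6.2, Lemma 6.3] [cite: Nolin2008, Thm. 11, Prop. 20, Thm. 27, §7.3 Prop. 34 and Remark 35 (arXiv 0711.4948: Thm. 10, Prop. 19, Thm. 26, Prop. 32, Remark 34)] -/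
theorem Werner2009_lemma62_of_altSeparation_of_bridge
    (hsepA : ∃ ε₁ > (0 : ℝ), ∀ ⦃ε : ℝ⦄, 0 < ε → ε < ε₁ →
      ∃ n₀ : ℕ, ∃ δ > (0 : ℝ), ∃ c > (0 : ℝ),
        ∀ t : unitInterval, 1 / 2 ≤ (t : ℝ) → (t : ℝ) < 1 / 2 + δ →
          ∀ n N : ℕ, n₀ ≤ n → 2 * n ≤ N → (1 / 2 < (t : ℝ) → N ≤ charLengthW ε t) →
            c * altFourArmProbAt t n N ≤ (triSitePercolation t).real (sepFourArm n N))
    (hBr : ∃ ε₁ > (0 : ℝ), ∀ ⦃ε : ℝ⦄, 0 < ε → ε < ε₁ →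
      ∃ n₀ : ℕ, ∃ δ > (0 : ℝ), ∃ c > (0 : ℝ),
        ∀ t : unitInterval, 1 / 2 ≤ (t : ℝ) → (t : ℝ) < 1 / 2 + δ →
          ∀ n N : ℕ, n₀ ≤ n → 2 * n ≤ N → (1 / 2 < (t : ℝ) → N ≤ charLengthW ε t) →
            c * fourArmProbAt t n N ≤ altFourArmProbAt t n N) :
    Werner2009_lemma62 :=
  Werner2009_lemma62_of_separation (sep_of_altSep_of_bridge hsepA hBr)

/-! ### `Werner2009_lemma62` from the alternating pivotal count and the fixed-radius critical bridge -/

/-- **`Werner2009_lemma62` from the alternating pivotal count and the fixed-radius bridge.** IF,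
for every small `ε` and every large inner radius `r₀`, there are `n₁, δ > 0, c > 0, C` with
`c · N² · P_{1/2}(altFourArm r₀ N) ≤ Σ_{x ∈ [0,N]²} P_t(x pivotal for 𝒞_H([0,N]²)) ≤ C · N² · P_{1/2}(altFourArm r₀ N)`
for `1/2 ≤ t < 1/2 + δ` and `n₁ ≤ N ≤ L(t, ε)` (Nolin 2008, Remark 35 [arXiv Remark 34]:
"`Σ_{x ∈ S_n} P(x pivotal) ≍ n² π₄(n)`", his `π₄` being the alternating four-arm probability at
`p = 1/2`; Werner 2009, Lemma 6.2 with Lemma 6.3 for his alternating `π̂`, read for the rhombus),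
AND for every large `r₀` there are `n₁, C` with `π₄(r₀, N) ≤ C · P_{1/2}(altFourArm r₀ N)` for
`N ≥ n₁` (the two arrangements of the order-free event are comparable at `p = 1/2`, Nolin 2008,
Prop. 20 for `j = 4` [arXiv Prop. 19], at a fixed inner radius; the hypothesis `hB` of
`Werner2009_lemma62W_of_altPivotal_of_fixedRadiusBridge`), THEN `Werner2009_lemma62`. The lower
bound loses the factor `max C 1`, the upper bound uses `P_{1/2}(altFourArm r₀ N) ≤ π₄(r₀, N)`;
Werner's conventions (`t ≥ 1/2`, `L(t, ε')` at `ε' = min ε (ε₁/2)`) are converted to the fact's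
(`|t - 1/2| < δ`, Nolin's `L_ε`) by `Werner2009_lemma62_of_half_le` and
`charLength_le_charLengthW_of_le`. So the content of the vendored statement beyond the printed
display is exactly the fixed-radius comparison at `p = 1/2`. [cite: Nolin2008, §7.3, Remark 35 and proof of Prop. 34; §5.1 Prop. 20 (arXiv 0711.4948: Remark 34, Prop. 32, Prop. 19)] [cite: WernerPCMI2009, Lecture 6, Lemma 6.2 and Lemma 6.3] -/
theorem Werner2009_lemma62_of_altPivotal_of_fixedRadiusBridge
    (hPS : ∃ ε₁ > (0 : ℝ), ∀ ⦃ε : ℝ⦄, 0 < ε → ε < ε₁ →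
      ∃ r₁ : ℕ, ∀ r₀ ≥ r₁, ∃ n₁ : ℕ, ∃ δ > (0 : ℝ), ∃ c > (0 : ℝ), ∃ C : ℝ,
        ∀ t : unitInterval, 1 / 2 ≤ (t : ℝ) → (t : ℝ) < 1 / 2 + δ →
          ∀ N : ℕ, n₁ ≤ N → (1 / 2 < (t : ℝ) → N ≤ charLengthW ε t) →
            c * ((N : ℝ) ^ 2 * altFourArmProbAt half r₀ N) ≤ rhombusPivotalSum t N ∧
              rhombusPivotalSum t N ≤ C * ((N : ℝ) ^ 2 * altFourArmProbAt half r₀ N))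
    (hB : ∃ r₁ : ℕ, ∀ r₀ ≥ r₁, ∃ n₁ : ℕ, ∃ C : ℝ, ∀ N : ℕ, n₁ ≤ N →
      critFourArmProb r₀ N ≤ C * altFourArmProbAt half r₀ N) :
    Werner2009_lemma62 := by
  obtain ⟨ε₁, hε₁, HPS⟩ := hPS
  obtain ⟨rB, hrB⟩ := hB
  refine Werner2009_lemma62_of_half_le fun ε hε _ => ?_
  -- a small auxiliary `ε'`
  set ε' : ℝ := min ε (ε₁ / 2) with hε'
  have hε'0 : 0 < ε' := lt_min hε (half_pos hε₁)
  have hε'ε : ε' ≤ ε := min_le_left _ _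
  have hε'1 : ε' < ε₁ := (min_le_right _ _).trans_lt (half_lt_self hε₁)
  obtain ⟨rA, hrA⟩ := HPS hε'0 hε'1
  refine ⟨max rA rB, fun r₀ hr₀ => ?_⟩
  obtain ⟨nA, δ, hδ, c, hc, C, hbA⟩ := hrA r₀ ((le_max_left _ _).trans hr₀)
  obtain ⟨nB, CB, hbB⟩ := hrB r₀ ((le_max_right _ _).trans hr₀)
  refine ⟨max nA nB, δ, hδ, c / max CB 1, div_pos hc (lt_of_lt_of_le one_pos (le_max_right _ _)),
    max C 0, fun t ht1 ht2 N hN hNL => ?_⟩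
  -- Nolin's length at `ε` is below Werner's at `ε'`
  have hW : 1 / 2 < (t : ℝ) → N ≤ charLengthW ε' t := fun h =>
    (hNL h).trans (charLength_le_charLengthW_of_le hε'0 hε'ε h.ne')
  obtain ⟨hA1, hA2⟩ := hbA t ht1 ht2 N ((le_max_left _ _).trans hN) hW
  have hBN := hbB N ((le_max_right _ _).trans hN)
  have ha0 : 0 ≤ altFourArmProbAt half r₀ N := altFourArmProbAt_nonneg half r₀ N
  have hN0 : (0 : ℝ) ≤ (N : ℝ) ^ 2 := sq_nonneg _
  have hM1 : (1 : ℝ) ≤ max CB 1 := le_max_right _ _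
  have hM0 : (0 : ℝ) < max CB 1 := lt_of_lt_of_le one_pos hM1
  -- the bridge with the constant `max CB 1`
  have hBN' : critFourArmProb r₀ N ≤ max CB 1 * altFourArmProbAt half r₀ N :=
    hBN.trans (mul_le_mul_of_nonneg_right (le_max_left _ _) ha0)
  -- the inclusion `altFourArm ⊆ armEvent`, at `t = 1/2`
  have hincl : altFourArmProbAt half r₀ N ≤ critFourArmProb r₀ N := by
    simpa only [fourArmProbAt_half] using altFourArmProbAt_le_fourArmProbAt half r₀ N
  constructor
  · calc c / max CB 1 * ((N : ℝ) ^ 2 * critFourArmProb r₀ N)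
        ≤ c / max CB 1 * ((N : ℝ) ^ 2 * (max CB 1 * altFourArmProbAt half r₀ N)) := by
          have hc' : 0 ≤ c / max CB 1 := (div_pos hc hM0).le
          exact mul_le_mul_of_nonneg_left (mul_le_mul_of_nonneg_left hBN' hN0) hc'
      _ = c * ((N : ℝ) ^ 2 * altFourArmProbAt half r₀ N) := by
          field_simp
      _ ≤ rhombusPivotalSum t N := hA1
  · calc rhombusPivotalSum t N ≤ C * ((N : ℝ) ^ 2 * altFourArmProbAt half r₀ N) := hA2
      _ ≤ max C 0 * ((N : ℝ) ^ 2 * altFourArmProbAt half r₀ N) :=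
          mul_le_mul_of_nonneg_right (le_max_left _ _) (mul_nonneg hN0 ha0)
      _ ≤ max C 0 * ((N : ℝ) ^ 2 * critFourArmProb r₀ N) :=
          mul_le_mul_of_nonneg_left (mul_le_mul_of_nonneg_left hincl hN0) (le_max_right _ _)

/-! ### The alternating composite from Lemma 6.2 (rhombus) and Lemma 6.3, alternating forms -/

/-- **Lemma 6.2 for the rhombus with Lemma 6.3, alternating form.** IF
`Σ_{x ∈ [0,N]²} P_t(x pivotal for 𝒞_H([0,N]²)) ≍ N² π̂^alt_t(r₀, N)` (Werner 2009, Lemma 6.2 read for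
the rhombus; Nolin 2008, proof of Prop. 34) and `π̂^alt_t(r₀, N) ≍ π̂^alt_{1/2}(r₀, N)`
(Lemma 6.3; Nolin's Thm. 27 for `j = 4`, `σ = BWBW`), both for `1/2 ≤ t < 1/2 + δ`,
`n₁ ≤ N ≤ L(t, ε)`, THEN `Σ_x P_t(x pivotal) ≍ N² π̂^alt_{1/2}(r₀, N)` with the product constants
— the rhombus twin of `altPivotal_of_altLemma62P_of_altLemma63` (`WernerKestenRelationAlt.lean`).
[cite: WernerPCMI2009, Lecture 6, Lemma 6.2 and Lemma 6.3] [cite: Nolin2008, §7.3 proof of Prop. 34, Remark 35 and Thm. 27 (arXiv 0711.4948: Prop. 32, Remark 34, Thm. 26)] -/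
theorem altRhombusPivotal_of_altLemma62_of_altLemma63
    (hP : ∃ ε₁ > (0 : ℝ), ∀ ⦃ε : ℝ⦄, 0 < ε → ε < ε₁ →
      ∃ r₁ : ℕ, ∀ r₀ ≥ r₁, ∃ n₁ : ℕ, ∃ δ > (0 : ℝ), ∃ c > (0 : ℝ), ∃ C : ℝ,
        ∀ t : unitInterval, 1 / 2 ≤ (t : ℝ) → (t : ℝ) < 1 / 2 + δ →
          ∀ N : ℕ, n₁ ≤ N → (1 / 2 < (t : ℝ) → N ≤ charLengthW ε t) →
            c * ((N : ℝ) ^ 2 * altFourArmProbAt t r₀ N) ≤ rhombusPivotalSum t N ∧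
              rhombusPivotalSum t N ≤ C * ((N : ℝ) ^ 2 * altFourArmProbAt t r₀ N))
    (hS : ∃ ε₁ > (0 : ℝ), ∀ ⦃ε : ℝ⦄, 0 < ε → ε < ε₁ →
      ∃ r₁ : ℕ, ∀ r₀ ≥ r₁, ∃ n₁ : ℕ, ∃ δ > (0 : ℝ), ∃ c > (0 : ℝ), ∃ C : ℝ,
        ∀ t : unitInterval, 1 / 2 ≤ (t : ℝ) → (t : ℝ) < 1 / 2 + δ →
          ∀ N : ℕ, n₁ ≤ N → (1 / 2 < (t : ℝ) → N ≤ charLengthW ε t) →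
            c * altFourArmProbAt half r₀ N ≤ altFourArmProbAt t r₀ N ∧
              altFourArmProbAt t r₀ N ≤ C * altFourArmProbAt half r₀ N) :
    ∃ ε₁ > (0 : ℝ), ∀ ⦃ε : ℝ⦄, 0 < ε → ε < ε₁ →
      ∃ r₁ : ℕ, ∀ r₀ ≥ r₁, ∃ n₁ : ℕ, ∃ δ > (0 : ℝ), ∃ c > (0 : ℝ), ∃ C : ℝ,
        ∀ t : unitInterval, 1 / 2 ≤ (t : ℝ) → (t : ℝ) < 1 / 2 + δ →
          ∀ N : ℕ, n₁ ≤ N → (1 / 2 < (t : ℝ) → N ≤ charLengthW ε t) →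
            c * ((N : ℝ) ^ 2 * altFourArmProbAt half r₀ N) ≤ rhombusPivotalSum t N ∧
              rhombusPivotalSum t N ≤ C * ((N : ℝ) ^ 2 * altFourArmProbAt half r₀ N) := by
  obtain ⟨εA, hεA, hA⟩ := hP
  obtain ⟨εB, hεB, hB⟩ := hS
  refine ⟨min εA εB, lt_min hεA hεB, fun ε hε hεlt => ?_⟩
  obtain ⟨rA, hrA⟩ := hA hε (hεlt.trans_le (min_le_left _ _))
  obtain ⟨rB, hrB⟩ := hB hε (hεlt.trans_le (min_le_right _ _))
  refine ⟨max rA rB, fun r₀ hr₀ => ?_⟩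
  obtain ⟨nA, δA, hδA, cA, hcA, CA, hbA⟩ := hrA r₀ ((le_max_left _ _).trans hr₀)
  obtain ⟨nB, δB, hδB, cB, hcB, CB, hbB⟩ := hrB r₀ ((le_max_right _ _).trans hr₀)
  refine ⟨max nA nB, min δA δB, lt_min hδA hδB, cA * cB, mul_pos hcA hcB, max CA 0 * max CB 0,
    fun t ht1 ht2 N hN hNL => ?_⟩
  have htA : (t : ℝ) < 1 / 2 + δA := by linarith [min_le_left δA δB]
  have htB : (t : ℝ) < 1 / 2 + δB := by linarith [min_le_right δA δB]
  obtain ⟨hA1, hA2⟩ := hbA t ht1 htA N ((le_max_left _ _).trans hN) hNL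
  obtain ⟨hB1, hB2⟩ := hbB t ht1 htB N ((le_max_right _ _).trans hN) hNL
  have hπ0 : 0 ≤ altFourArmProbAt half r₀ N := altFourArmProbAt_nonneg half r₀ N
  have hN0 : (0 : ℝ) ≤ (N : ℝ) ^ 2 := sq_nonneg _
  constructor
  · calc cA * cB * ((N : ℝ) ^ 2 * altFourArmProbAt half r₀ N)
        = cA * ((N : ℝ) ^ 2 * (cB * altFourArmProbAt half r₀ N)) := by ring
      _ ≤ cA * ((N : ℝ) ^ 2 * altFourArmProbAt t r₀ N) := by gcongr
      _ ≤ rhombusPivotalSum t N := hA1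
  · calc rhombusPivotalSum t N ≤ CA * ((N : ℝ) ^ 2 * altFourArmProbAt t r₀ N) := hA2
      _ ≤ max CA 0 * ((N : ℝ) ^ 2 * altFourArmProbAt t r₀ N) :=
          mul_le_mul_of_nonneg_right (le_max_left _ _)
            (mul_nonneg hN0 (altFourArmProbAt_nonneg t r₀ N))
      _ ≤ max CA 0 * ((N : ℝ) ^ 2 * (max CB 0 * altFourArmProbAt half r₀ N)) := by
          have h4 : altFourArmProbAt t r₀ N ≤ max CB 0 * altFourArmProbAt half r₀ N :=
            hB2.trans (mul_le_mul_of_nonneg_right (le_max_left _ _) hπ0)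
          exact mul_le_mul_of_nonneg_left (mul_le_mul_of_nonneg_left h4 hN0) (le_max_right _ _)
      _ = max CA 0 * max CB 0 * ((N : ℝ) ^ 2 * altFourArmProbAt half r₀ N) := by ring

/-- **`Werner2009_lemma62` from the alternating arm calculus and the fixed-radius bridge**:
Lemma 6.2 read for the rhombus (`hP`) and Lemma 6.3 (`hS`) of Werner 2009, Lecture 6, for his
alternating `π̂` (`altFourArmProbAt`), and the comparison
`π₄(r₀, N) ≤ C(r₀) · P_{1/2}(altFourArm r₀ N)` of the order-free with the alternating event at
`p = 1/2` and fixed inner radius (`hB`; Nolin 2008, Prop. 20 for `j = 4` [arXiv Prop. 19]); the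
rhombus twin of `Werner2009_lemma62W_of_alt`. [cite: WernerPCMI2009, Lecture 6, Lemma 6.2 and Lemma 6.3] [cite: Nolin2008, §7.3 Remark 35 and §5.1 Prop. 20 (arXiv 0711.4948: Remark 34, Prop. 19)] -/
theorem Werner2009_lemma62_of_alt
    (hP : ∃ ε₁ > (0 : ℝ), ∀ ⦃ε : ℝ⦄, 0 < ε → ε < ε₁ →
      ∃ r₁ : ℕ, ∀ r₀ ≥ r₁, ∃ n₁ : ℕ, ∃ δ > (0 : ℝ), ∃ c > (0 : ℝ), ∃ C : ℝ,
        ∀ t : unitInterval, 1 / 2 ≤ (t : ℝ) → (t : ℝ) < 1 / 2 + δ →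
          ∀ N : ℕ, n₁ ≤ N → (1 / 2 < (t : ℝ) → N ≤ charLengthW ε t) →
            c * ((N : ℝ) ^ 2 * altFourArmProbAt t r₀ N) ≤ rhombusPivotalSum t N ∧
              rhombusPivotalSum t N ≤ C * ((N : ℝ) ^ 2 * altFourArmProbAt t r₀ N))
    (hS : ∃ ε₁ > (0 : ℝ), ∀ ⦃ε : ℝ⦄, 0 < ε → ε < ε₁ →
      ∃ r₁ : ℕ, ∀ r₀ ≥ r₁, ∃ n₁ : ℕ, ∃ δ > (0 : ℝ), ∃ c > (0 : ℝ), ∃ C : ℝ,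
        ∀ t : unitInterval, 1 / 2 ≤ (t : ℝ) → (t : ℝ) < 1 / 2 + δ →
          ∀ N : ℕ, n₁ ≤ N → (1 / 2 < (t : ℝ) → N ≤ charLengthW ε t) →
            c * altFourArmProbAt half r₀ N ≤ altFourArmProbAt t r₀ N ∧
              altFourArmProbAt t r₀ N ≤ C * altFourArmProbAt half r₀ N)
    (hB : ∃ r₁ : ℕ, ∀ r₀ ≥ r₁, ∃ n₁ : ℕ, ∃ C : ℝ, ∀ N : ℕ, n₁ ≤ N →
      critFourArmProb r₀ N ≤ C * altFourArmProbAt half r₀ N) :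
    Werner2009_lemma62 :=
  Werner2009_lemma62_of_altPivotal_of_fixedRadiusBridge
    (altRhombusPivotal_of_altLemma62_of_altLemma63 hP hS) hB

/-- **`Werner2009_lemma62` from the alternating arm calculus and the UNIFORM critical bridge**
(`c · π₄(n, N) ≤ P_{1/2}(altFourArm n N)` for `n₀ ≤ n`, `2n ≤ N`, Nolin 2008, Prop. 20 for
`j = 4` as printed; the hypothesis `hBr` of `critFourArm_separation_of_alt`,
`ArmPatternsFourArm.lean`): `Werner2009_lemma62_of_alt` with the fixed-radius bridge it implies
(`fixedRadiusBridge_of_bridge` of `WernerKestenRelationAlt.lean`, restated privately above).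
[cite: WernerPCMI2009, Lecture 6, Lemma 6.2 and Lemma 6.3] [cite: Nolin2008, §5.1 Prop. 20 (arXiv 0711.4948: Prop. 19)] -/
theorem Werner2009_lemma62_of_alt_of_bridge
    (hP : ∃ ε₁ > (0 : ℝ), ∀ ⦃ε : ℝ⦄, 0 < ε → ε < ε₁ →
      ∃ r₁ : ℕ, ∀ r₀ ≥ r₁, ∃ n₁ : ℕ, ∃ δ > (0 : ℝ), ∃ c > (0 : ℝ), ∃ C : ℝ,
        ∀ t : unitInterval, 1 / 2 ≤ (t : ℝ) → (t : ℝ) < 1 / 2 + δ →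
          ∀ N : ℕ, n₁ ≤ N → (1 / 2 < (t : ℝ) → N ≤ charLengthW ε t) →
            c * ((N : ℝ) ^ 2 * altFourArmProbAt t r₀ N) ≤ rhombusPivotalSum t N ∧
              rhombusPivotalSum t N ≤ C * ((N : ℝ) ^ 2 * altFourArmProbAt t r₀ N))
    (hS : ∃ ε₁ > (0 : ℝ), ∀ ⦃ε : ℝ⦄, 0 < ε → ε < ε₁ →
      ∃ r₁ : ℕ, ∀ r₀ ≥ r₁, ∃ n₁ : ℕ, ∃ δ > (0 : ℝ), ∃ c > (0 : ℝ), ∃ C : ℝ,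
        ∀ t : unitInterval, 1 / 2 ≤ (t : ℝ) → (t : ℝ) < 1 / 2 + δ →
          ∀ N : ℕ, n₁ ≤ N → (1 / 2 < (t : ℝ) → N ≤ charLengthW ε t) →
            c * altFourArmProbAt half r₀ N ≤ altFourArmProbAt t r₀ N ∧
              altFourArmProbAt t r₀ N ≤ C * altFourArmProbAt half r₀ N)
    (hBr : ∃ c : ℝ, 0 < c ∧ ∃ n₀ : ℕ, ∀ n N : ℕ, n₀ ≤ n → 2 * n ≤ N →
      c * critFourArmProb n N ≤ (triSitePercolation half).real (altFourArm n N)) :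
    Werner2009_lemma62 :=
  Werner2009_lemma62_of_alt hP hS (fixedRadius_of_bridge hBr)

/-! ### What remains beyond alternating separation -/

/-- **`Werner2009_lemma62` from alternating separation, the alternating UPPER pivotal bound,
alternating four-arm stability and the fixed-radius bridge.** The lower half of the alternating
Lemma 6.2 for the rhombus is supplied by `(hsepA)` (`rhombusPivotalSum_lower_alt_of_altSeparation`);
what the fact needs beyond it is displayed: the upper half
`Σ_x P_t(x pivotal) ≤ C N² π̂^alt_t(r₀, N)` below `L(t, ε)` (Werner 2009, proof of Lemma 6.2,
upper bound, for his alternating `π̂`; Nolin 2008, (7.21)–(7.24)), the alternating Lemma 6.3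
(Nolin's Thm. 27 for `σ = BWBW`) and Prop. 20 at `p = 1/2` at a fixed inner radius. [cite: WernerPCMI2009, Lecture 6, Lemma 6.2 (proof), Lemma 6.3, Prop. 6.1] [cite: Nolin2008, Thm. 11, Thm. 27, §7.3 Prop. 34 (proof) and Remark 35, §5.1 Prop. 20 (arXiv 0711.4948: Thm. 10, Thm. 26, Prop. 32, Remark 34, Prop. 19)] -/
theorem Werner2009_lemma62_of_altSeparation_of_altUpper_of_altStability
    (hsepA : ∃ ε₁ > (0 : ℝ), ∀ ⦃ε : ℝ⦄, 0 < ε → ε < ε₁ →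
      ∃ n₀ : ℕ, ∃ δ > (0 : ℝ), ∃ c > (0 : ℝ),
        ∀ t : unitInterval, 1 / 2 ≤ (t : ℝ) → (t : ℝ) < 1 / 2 + δ →
          ∀ n N : ℕ, n₀ ≤ n → 2 * n ≤ N → (1 / 2 < (t : ℝ) → N ≤ charLengthW ε t) →
            c * altFourArmProbAt t n N ≤ (triSitePercolation t).real (sepFourArm n N))
    (hU : ∃ ε₁ > (0 : ℝ), ∀ ⦃ε : ℝ⦄, 0 < ε → ε < ε₁ →
      ∃ r₁ : ℕ, ∀ r₀ ≥ r₁, ∃ n₁ : ℕ, ∃ δ > (0 : ℝ), ∃ C : ℝ,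
        ∀ t : unitInterval, 1 / 2 ≤ (t : ℝ) → (t : ℝ) < 1 / 2 + δ →
          ∀ N : ℕ, n₁ ≤ N → (1 / 2 < (t : ℝ) → N ≤ charLengthW ε t) →
            rhombusPivotalSum t N ≤ C * ((N : ℝ) ^ 2 * altFourArmProbAt t r₀ N))
    (hS : ∃ ε₁ > (0 : ℝ), ∀ ⦃ε : ℝ⦄, 0 < ε → ε < ε₁ →
      ∃ r₁ : ℕ, ∀ r₀ ≥ r₁, ∃ n₁ : ℕ, ∃ δ > (0 : ℝ), ∃ c > (0 : ℝ), ∃ C : ℝ,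
        ∀ t : unitInterval, 1 / 2 ≤ (t : ℝ) → (t : ℝ) < 1 / 2 + δ →
          ∀ N : ℕ, n₁ ≤ N → (1 / 2 < (t : ℝ) → N ≤ charLengthW ε t) →
            c * altFourArmProbAt half r₀ N ≤ altFourArmProbAt t r₀ N ∧
              altFourArmProbAt t r₀ N ≤ C * altFourArmProbAt half r₀ N)
    (hB : ∃ r₁ : ℕ, ∀ r₀ ≥ r₁, ∃ n₁ : ℕ, ∃ C : ℝ, ∀ N : ℕ, n₁ ≤ N →
      critFourArmProb r₀ N ≤ C * altFourArmProbAt half r₀ N) :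
    Werner2009_lemma62 := by
  refine Werner2009_lemma62_of_alt ?_ hS hB
  -- the two halves of the alternating Lemma 6.2 for the rhombus, combined
  obtain ⟨εL, hεL, HL⟩ := rhombusPivotalSum_lower_alt_of_altSeparation hsepA
  obtain ⟨εU, hεU, HU⟩ := hU
  refine ⟨min εL εU, lt_min hεL hεU, fun ε hε hεlt => ?_⟩
  obtain ⟨rL, HL⟩ := HL hε (hεlt.trans_le (min_le_left _ _))
  obtain ⟨rU, HU⟩ := HU hε (hεlt.trans_le (min_le_right _ _))
  refine ⟨max rL rU, fun r₀ hr₀ => ?_⟩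
  obtain ⟨nL, δL, hδL, c, hc, HL⟩ := HL r₀ ((le_max_left _ _).trans hr₀)
  obtain ⟨nU, δU, hδU, C, HU⟩ := HU r₀ ((le_max_right _ _).trans hr₀)
  refine ⟨max nL nU, min δL δU, lt_min hδL hδU, c, hc, C, fun t ht1 ht2 N hN hNL => ⟨?_, ?_⟩⟩
  · exact HL t ht1 (by linarith [min_le_left δL δU]) N ((le_max_left _ _).trans hN) hNL
  · exact HU t ht1 (by linarith [min_le_right δL δU]) N ((le_max_right _ _).trans hN) hNL

end Literature.Probability.Percolation

end
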